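import Summits.SmoothPoincare4.SmoothPoincare4.Theorems.SymplecticOrigamiNoGenusTwoDoorStubTaubesCanonicalCurveCupLemma
import Summits.SmoothPoincare4.SmoothPoincare4.Theorems.SymplecticOrigamiNoGenusTwoDoorStubTaubesCanonicalCurveDoorLattice
import Literature.AlgebraicTopology.SingularHomology.SingularChains
import Literature.AlgebraicTopology.SingularHomology.PoincareDuality
import Literature.AlgebraicTopology.SingularHomology.PoincareDualityProofs
import Literature.AlgebraicTopology.SingularHomology.CupProduct
import Literature.AlgebraicTopology.SingularHomology.IntersectionForm
import Literature.AlgebraicTopology.SingularHomology.EulerCharacteristicTriple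
import Literature.Topology.FourManifolds.IntersectionLattice
import Literature.Topology.FourManifolds.SPC4Wave0
import Literature.Geometry.Symplectic.CanonicalClassSqAndAdjunctionOfSymplecticFour
import Literature.Geometry.Kaehler.ManifoldForms
import Literature.Geometry.Kaehler.ManifoldFormsPullback
import Literature.Geometry.Symplectic.TaubesCanonicalClassSymplecticCurveFour

/-! # Stub `stub_taubesCanonicalCurve` of line `canonical-cap-filling` for crux `NoGenusTwoDoor`
(stmt-SmoothPoincare4-7842, route SymplecticOrigami) — CLOSED MODULO ONE NAMED FACT

**Statement (S1, Taubes canonical curve).** A DOOR — a closed connected symplectic `4`-manifold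
`(N, s)` (`s : MForm`, chartwise smooth, closed, pointwise non-degenerate) with
`(rank H₁(N; ℤ), rank H₂(N; ℤ)) = (2, 1)` — contains a smoothly embedded compact connected
`s`-symplectic surface `B = b(S)` of genus `2` (`rank H₁(S; ℤ) = 4`) whose complement has
MERIDIAN INJECTIVITY: `H₁(N ∖ B; ℤ) → H₁(N; ℤ)` is injective.

**What is proved here.** `stub_taubesCanonicalCurve_of_taubes`: the statement, VERBATIM as
registered, from two named facts —
* `taubes_canonicalClass_symplecticCurve_four` (NEW, stated below in the tree's vocabulary and in
  its general published form; Taubes 1994/1995/1996 with the `b⁺ = 1` extension of Li–Liu 1995):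
  the canonical class `K` of a closed symplectic `4`-manifold with non-vanishing Seiberg–Witten
  invariant of `K` (always when `b⁺ ≥ 2`; when `b⁺ = 1`, whenever `b₁ ≥ 1` and the cup product
  `H¹ ⊗ H¹ → H²` vanishes rationally, so that all wall-crossing numbers vanish) is Poincaré dual
  to an embedded symplectic curve `Σ mᵢ Cᵢ`, each component `ω`-positive and satisfying
  adjunction;
* `Literature.Geometry.Symplectic.thomGysin_complement_surface_four` (IN THE TREE): the
  Thom–Gysin sequence `H₂(N) →(·S) ℤ → H₁(N ∖ S) → H₁(N) → 0` of a smooth closed surface.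

**Proof.** `b₂ = 1` and `b⁺ ≥ 1` give `(b⁺, b⁻) = (1, 0)`, `σ = 1`, `χ = -1`
(`…DoorLattice`), so `K² = 2χ + 3σ = 1`; in the coordinate `e : H²(N; ℤ)/T ≃ ℤ` of the odd
unimodular rank-one lattice (`Q(x, y) = e(x) e(y)`), `K ≡ k` with `k² = 1`.  The cup lemma
(`…CupLemma`, `dim_ℚ H²(N; ℚ) = 1`) and `b₁ = 2 ≥ 1` discharge the `b⁺ = 1` hypothesis of the
Taubes fact, which yields components `Cᵢ = bᵢ(Sᵢ)` with multiplicities `mᵢ ≥ 1`, classes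
`cᵢ = PD(σᵢ)`, `σᵢ ≡ nᵢ`, `Σ mᵢ nᵢ = k`, a real additive `A` (symplectic area) with
`A(cᵢ) = nᵢ·λ > 0`, and adjunction `b₁(Sᵢ) - 2 = nᵢ² + k nᵢ`.  All `nᵢ` have the sign of `λ`,
so `|Σ mᵢ nᵢ| ≥ #components`, whence exactly ONE component, `m = 1`, `n = k = ±1`,
`b₁(S) = 2 + 1 + 1 = 4`; and `⟨g ⌣ σ, [N]⟩ = e(g)·n = ±1` for a lift `g` of the generator makes
`x ↦ x·S` onto `ℤ`, so the Thom–Gysin connecting map vanishes and `H₁(N ∖ S) → H₁(N)` is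
injective.  Compactness of `N` is used throughout (Poincaré duality, finiteness; cf. the
non-compact door `T*T²` of `Theorems/NoGenusTwoDoor/Negative/NoncompactDoor`).

Sources: Taubes, MRL 1 (1994) 809 (Main Thm.); Taubes, MRL 2 (1995) 221 (Thm. A(1), §3 (3.2),
Thm. 4.1, Prop. 4.2); Taubes, JAMS 9 (1996) 845; Li–Liu, MRL 2 (1995) 453 (§0: Thms. 1, 4 hold
for `b⁺ = 1` in Taubes' chamber) and MRL 2 (1995) 797 (Thm. 1.2, Cor. 1.3: wall-crossing
numbers from cup products on `H¹`); McDuff–Salamon (2017) Rem. 4.1.10, §4.4; Bredon (1993)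
VI.11; Hatcher (2002) §3.3.
-/

noncomputable section
-- the prescribed namespace `Summit.<P>.<Sub>.…` duplicates `SmoothPoincare4` (P = Sub)
set_option linter.dupNamespace false
open scoped Manifold ContDiff Topology ContinuousMap
open Set Function TopologicalSpace
open Literature.Geometry.Kaehler (MForm IsSmoothForm IsClosedForm mextDeriv)
open Literature.AlgebraicTopology.SingularHomology
open Literature.Topology.FourManifolds (singularHomologyZ)

namespace Summit.SmoothPoincare4.SmoothPoincare4.Theorems.NoGenusTwoDoor.CanonicalCapFilling

/-- Model space `ℝⁿ`. -/
local notation "𝔼" n:arg => EuclideanSpace ℝ (Fin n)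

/-! ### The named fact -/

/-- **One component.** If integers `nᵢ` all lie strictly on one side of `0` (`0 < nᵢ·t` for a
fixed real `t`, the symplectic areas `mᵢ nᵢ λ > 0`), `mᵢ ≥ 1`, and `Σ mᵢ nᵢ = k` with `k² = 1`,
then there is exactly one index, `m = 1` and `n = k`. [folklore] -/
theorem eq_one_of_sum_mul_eq_unit {r : ℕ} {m : Fin r → ℕ} {n : Fin r → ℤ} {k : ℤ} {t : ℝ}
    (hm : ∀ i, 1 ≤ m i) (hpos : ∀ i, 0 < (n i : ℝ) * t) (hsum : ∑ i, (m i : ℤ) * n i = k)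
    (hk : k * k = 1) : r = 1 ∧ ∀ i, m i = 1 ∧ n i = k := by
  have hk' : k = 1 ∨ k = -1 := Int.eq_one_or_neg_one_of_mul_eq_one hk
  have hr0 : r ≠ 0 := by
    rintro rfl
    simp only [Finset.univ_eq_empty, Finset.sum_empty] at hsum
    subst hsum
    simp at hk
  obtain ⟨i₀⟩ : Nonempty (Fin r) := Fin.pos_iff_nonempty.mp (Nat.pos_of_ne_zero hr0)
  have ht0 : t ≠ 0 := fun h ↦ by simpa [h] using hpos i₀
  rcases lt_or_gt_of_ne ht0 with ht | ht
  · -- all `nᵢ < 0`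
    have hn : ∀ i, n i ≤ -1 := fun i ↦ by
      have h := hpos i
      have : (n i : ℝ) < 0 := by nlinarith
      exact Int.le_sub_one_of_lt (by exact_mod_cast this)
    have hterm : ∀ i ∈ Finset.univ, (m i : ℤ) * n i ≤ -1 := fun i _ ↦ by nlinarith [hm i, hn i]
    have hle := Finset.sum_le_card_nsmul _ _ _ hterm
    rw [hsum, Finset.card_univ, Fintype.card_fin, smul_neg, nsmul_eq_mul, mul_one] at hle
    have hr1 : r = 1 := by rcases hk' with rfl | rfl <;> omega
    subst hr1
    refine ⟨rfl, fun i ↦ ?_⟩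
    have hi : i = 0 := Subsingleton.elim _ _
    subst hi
    rw [Fin.sum_univ_one] at hsum
    rcases hk' with rfl | rfl
    · nlinarith [hm 0, hn 0]
    · rcases Int.eq_one_or_neg_one_of_mul_eq_neg_one' hsum with ⟨h1, h2⟩ | ⟨h1, h2⟩
      · exact ⟨by exact_mod_cast h1, h2⟩
      · have := hm 0; omega
  · -- all `nᵢ > 0`
    have hn : ∀ i, 1 ≤ n i := fun i ↦ by
      have h := hpos i
      have : (0 : ℝ) < n i := by nlinarith
      exact Int.add_one_le_of_lt (by exact_mod_cast this)
    have hterm : ∀ i ∈ Finset.univ, (1 : ℤ) ≤ (m i : ℤ) * n i := fun i _ ↦ by nlinarith [hm i, hn i]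
    have hle := Finset.card_nsmul_le_sum _ _ _ hterm
    rw [hsum, Finset.card_univ, Fintype.card_fin, nsmul_eq_mul, mul_one] at hle
    have hr1 : r = 1 := by rcases hk' with rfl | rfl <;> omega
    subst hr1
    refine ⟨rfl, fun i ↦ ?_⟩
    have hi : i = 0 := Subsingleton.elim _ _
    subst hi
    rw [Fin.sum_univ_one] at hsum
    rcases hk' with rfl | rfl
    · rcases Int.eq_one_or_neg_one_of_mul_eq_one' hsum with ⟨h1, h2⟩ | ⟨h1, h2⟩
      · exact ⟨by exact_mod_cast h1, h2⟩
      · have := hm 0; omega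
    · nlinarith [hm 0, hn 0]

/-! ### The stub, closed modulo the named facts -/

/-- **STUB S1 (Taubes canonical curve), conditional form.** Assuming the named facts
`taubes_canonicalClass_symplecticCurve_four` (Taubes 1994–96 with Li–Liu 1995) and
`thomGysin_complement_surface_four` (Bredon VI.11 / Hatcher §3.3, in the tree), every door
`(N, s)` contains a smoothly embedded compact connected `s`-symplectic genus-`2` surface
`B = b(S)` (`rank H₁(S; ℤ) = 4`) with `H₁(N ∖ B; ℤ) → H₁(N; ℤ)` injective — the registered
signature of `stub_taubesCanonicalCurve`, verbatim, as conclusion. Proof in the module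
docstring. [cite: Taubes1995, Thm. A (1) and Prop. 4.2] -/
theorem stub_taubesCanonicalCurve_of_taubes :
    Literature.Geometry.Symplectic.taubes_canonicalClass_symplecticCurve_four →
    Literature.Geometry.Symplectic.thomGysin_complement_surface_four →
    ∀ (N : Type) [TopologicalSpace N] [T2Space N] [SecondCountableTopology N] [CompactSpace N]
      [ConnectedSpace N] [ChartedSpace (𝔼 4) N] [IsManifold (𝓡 4) ∞ N] (s : MForm (𝓡 4) N ℝ 2),
      IsSmoothForm s → IsClosedForm s →
      (∀ x (v : TangentSpace (𝓡 4) x), v ≠ 0 → ∃ w, s x ![v, w] ≠ 0) →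
      Module.finrank ℤ (singularHomologyZ N 1) = 2 → Module.finrank ℤ (singularHomologyZ N 2) = 1 →
      ∃ (S : Type) (_ : TopologicalSpace S) (_ : T2Space S) (_ : CompactSpace S)
        (_ : ConnectedSpace S) (_ : ChartedSpace (𝔼 2) S) (_ : IsManifold (𝓡 2) ∞ S) (b : S → N),
        Module.finrank ℤ (singularHomologyZ S 1) = 4 ∧
        Manifold.IsSmoothEmbedding (𝓡 2) (𝓡 4) ∞ b ∧
        (∀ y (v : TangentSpace (𝓡 2) y), v ≠ 0 → ∃ w : TangentSpace (𝓡 2) y,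
          s (b y) ![mfderiv (𝓡 2) (𝓡 4) b y v, mfderiv (𝓡 2) (𝓡 4) b y w] ≠ 0) ∧
        Function.Injective (singularHomology.map ℤ ℤ
          (⟨Subtype.val, continuous_subtype_val⟩ : C(↥(Set.range b)ᶜ, N)) 1) := by
  intro hT hTG N _ _ _ _ _ _ _ s hs hcl hnd hb1 hb2
  have hb1' : Module.finrank ℤ (singularHomology ℤ ℤ N 1) = 2 := hb1
  have hb2' : Module.finrank ℤ (singularHomology ℤ ℤ N 2) = 1 := hb2
  obtain ⟨μ, K, hpos, hKK, hTaubes⟩ := hT N s hs hcl hnd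
  -- the numerics of the door
  obtain ⟨hsp, -⟩ := sigPos_eq_one_and_sigNeg_eq_zero μ hpos hb2'
  have hK1 : cupPairing μ two_add_two_eq_four K K = 1 := by
    rw [hKK, relEuler_eq_neg_one_of_door μ hb1' hb2', signature_eq_one_of_door μ hpos hb2']
    norm_num
  have hcup : ∀ a b : singularCohomology ℚ ℚ N 1, cupProduct one_add_one_eq_two a b = 0 :=
    cupProduct_one_one_eq_zero_rat ⟨μ⟩ (finrank_rat_singularCohomology_two_eq_one hb2')
  obtain ⟨r, S, _, _, _, _, _, b, hb, μS, m, A, hm, hsymp, -, hsum, hcomp⟩ :=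
    hTaubes (Or.inr ⟨hsp, by omega, hcup⟩)
  -- the rank-one lattice `H²(N; ℤ)/T = ℤ`, `Q(x, y) = e(x) e(y)`
  obtain ⟨e, he⟩ := exists_linearEquiv_intersectionForm_of_door μ hpos hb2'
  set π : singularCohomology ℤ ℤ N 2 →ₗ[ℤ] freeCohomology ℤ N 2 := freeCohomology.mk with hπ
  have hQ : ∀ x y : singularCohomology ℤ ℤ N 2,
      cupPairing μ two_add_two_eq_four x y = e (π x) * e (π y) := fun x y ↦ by
    rw [← intersectionForm_mk_mk]; exact he _ _
  set k : ℤ := e (π K) with hk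
  have hk1 : k * k = 1 := by rw [hk, ← hQ K K, hK1]
  -- Poincaré duality and the classes of the components
  set D := poincareDualityEquiv μ two_add_two_eq_four (poincare_duality μ two_add_two_eq_four)
    with hD
  set c : Fin r → singularHomology ℤ ℤ N 2 := fun i ↦
    singularHomology.map ℤ ℤ ⟨b i, (hb i).isEmbedding.continuous⟩ 2 (μS i).fundamentalClass
    with hc
  set σ : Fin r → singularCohomology ℤ ℤ N 2 := fun i ↦ D.symm (c i) with hσdef
  have hσ : ∀ i, poincareDualityMap μ two_add_two_eq_four (σ i) = c i := fun i ↦ by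
    rw [← poincareDualityEquiv_apply μ two_add_two_eq_four (poincare_duality μ _), ← hD, hσdef]
    exact D.apply_symm_apply (c i)
  set n : Fin r → ℤ := fun i ↦ e (π (σ i)) with hn
  -- `Σ mᵢ σᵢ = K`, hence `Σ mᵢ nᵢ = k`
  have hsumσ : ∑ i, (m i : ℤ) • σ i = K := by
    apply D.injective
    rw [map_sum, poincareDualityEquiv_apply, ← hsum]
    refine Finset.sum_congr rfl fun i _ ↦ ?_
    rw [map_zsmul, hσdef]
    exact congrArg _ (D.apply_symm_apply (c i))
  have hmn : ∑ i, (m i : ℤ) * n i = k := by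
    have h := congrArg (fun x ↦ e (π x)) hsumσ
    simpa only [map_sum, map_zsmul, zsmul_eq_mul, Int.cast_id] using h
  -- positivity: `A(cᵢ) = nᵢ · A'(g')`
  set A' : singularCohomology ℤ ℤ N 2 →ₗ[ℤ] ℝ := A.comp D.toLinearMap with hA'
  obtain ⟨g', hg'⟩ := freeCohomology.mk_surjective (R := ℤ) (X := N) (k := 2) (e.symm 1)
  have hkerπ : LinearMap.ker π ≤ Submodule.torsion ℤ (singularCohomology ℤ ℤ N 2) := by
    rw [hπ, freeCohomology.ker_mk]
  have hApos : ∀ i, 0 < (n i : ℝ) * A' g' := fun i ↦ by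
    have h1 : A (c i) = A' (σ i) := by
      rw [hA', LinearMap.comp_apply, LinearEquiv.coe_coe, hσdef, LinearEquiv.apply_symm_apply]
    have h2 := linearMap_apply_eq_of_linearEquiv A' π hkerπ e g' hg' (σ i)
    rw [zsmul_eq_mul] at h2
    have h3 := (hcomp i).1
    rw [h1, h2] at h3
    exact h3
  -- exactly one component, `m = 1`, `n = k`
  obtain ⟨hr1, hmn1⟩ := eq_one_of_sum_mul_eq_unit hm hApos hmn hk1
  subst hr1
  obtain ⟨-, hn0⟩ := hmn1 0
  have hnk : e (π (σ 0)) = k := hn0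
  -- genus two
  have hadj := (hcomp 0).2 (σ 0) (hσ 0)
  rw [hQ, hQ, ← hk, hnk, hk1] at hadj
  have hb1S : Module.finrank ℤ (singularHomology ℤ ℤ (S 0) 1) = 4 := by omega
  -- meridian injectivity from the Thom–Gysin sequence and `g·S = ±1`
  obtain ⟨-, δ, hrange, hkerδ⟩ := hTG N μ (S 0) (μS 0) (b 0) (hb 0) (σ 0) (hσ 0)
  have hone : (1 : ℤ) ∈ LinearMap.range ((cupPairing μ two_add_two_eq_four).flip (σ 0)) := by
    have hg'1 : e (π g') = 1 := by rw [hg', LinearEquiv.apply_symm_apply]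
    rcases Int.eq_one_or_neg_one_of_mul_eq_one hk1 with hk' | hk'
    · refine ⟨g', ?_⟩
      rw [LinearMap.flip_apply, hQ, hg'1, hnk, hk', mul_one]
    · refine ⟨-g', ?_⟩
      rw [LinearMap.flip_apply, hQ, map_neg, map_neg, hg'1, hnk, hk']
      norm_num
  have htop : LinearMap.range ((cupPairing μ two_add_two_eq_four).flip (σ 0)) = ⊤ :=
    Ideal.eq_top_of_isUnit_mem _ hone isUnit_one
  have hδ : δ = 0 := LinearMap.ker_eq_top.mp (hkerδ.trans htop)
  have hkerι : LinearMap.ker (singularHomology.map ℤ ℤ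
      (⟨Subtype.val, continuous_subtype_val⟩ : C(↥((Set.range (b 0))ᶜ), N)) 1).hom = ⊥ := by
    rw [← hrange, hδ, LinearMap.range_zero]
  haveI : T2Space (S 0) := (hb 0).isEmbedding.t2Space
  exact ⟨S 0, inferInstance, inferInstance, inferInstance, inferInstance, inferInstance,
    inferInstance, b 0, hb1S, hb 0, hsymp 0, LinearMap.ker_eq_bot.mp hkerι⟩

end Summit.SmoothPoincare4.SmoothPoincare4.Theorems.NoGenusTwoDoor.CanonicalCapFilling
end
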